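import Literature.Analysis.Asymptotics.PoincareRatioTheorem
import Summits.KontsevichZagierPeriods.Zeta5Search.TailSqueeze
import Summits.KontsevichZagierPeriods.Zeta5Search.Certificates.RowCertificate
import HarnessLib

/-!
# ζ(5) search — ORDER-3 families: from two ratio boxes + Poincaré data to a `RateCertificate` (cell `pub-zeta5`, certifier `cert-1`)

HONEST FRAMING: systematic search; no irrationality claim unless certified.

Every known ζ(5) recursion (Zudilin 2002 = Brown–Zudilin totally symmetric, the Brown–Zudilin rays) has
ORDER 3. The typer's chain `Zudilin2002Growth` → `Zudilin2002Casoratian(*Rates/Sharp)` → `Zudilin2002Decay`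
certified the symmetric family's exact rates by hand; this file is the GENERIC wrapper promised in
`CERTIFY-HOWTO.md` §10 ("order 3: build the `RateCertificate` from boxes + Poincaré-3 + the Casoratian /
TailSqueeze route"), so that a new order-3 candidate is a fill-in-the-fields exercise:

`OrderThreeRates ξ` — finitary/limit data:
* the rational solutions `u, v` (`vₙ/uₙ → ξ`, the one analytic identification: `tendsto_div`);
* a POSITIVE real gauge `U` of `|uₙ|` (`|uₙ| = Uₙ`, e.g. `(−1)^{n+1}qₙ`) solving a Poincaré recurrence
  `U(n+3) = aₙU(n+2) + bₙU(n+1) + cₙUₙ` (`aₙ → A`, …), a LOWER ratio bound `L·Uₙ ≤ Uₙ₊₁` (from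
  `RecurrenceGrowthOrderThree.ratio_bounds_of_recurrence3_*` + `PolyPositivity`), the root `λ` with
  `L ≤ λ` and the contraction `|B|/L² + 2|C|/L³ < 1` (then `Uₙ₊₁/Uₙ → λ`, Poincaré);
* the same for a positive gauge `W` of the Casoratian `|uₙvₙ₊₁ − uₙ₊₁vₙ|` (its recurrence is the
  exterior square `casoratian3_rec`, or any other the instance proves), with ALSO an upper ratio bound
  `Wₙ₊₁ ≤ Λ_W·Wₙ`, root `ν`, and the two scalar conditions `Λ_W/L² < 1/2` (tail-squeeze contraction)
  and `ν < λ` (the forms decay).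
OUTPUT (all PROVED here, 0 sorry): `tendsto_log_abs_u_div : log|uₙ|/n → log λ`,
`tendsto_log_W_div : log Wₙ/n → log ν`, `tendsto_log_abs_sub_div : log|ξ − vₙ/uₙ|/n → log ν − 2 log λ`,
`tendsto_log_abs_form_div : log|uₙξ − vₙ|/n → log ν − log λ`, `form_ne_zero`, `casoratian_ne_zero`, and
**`OrderThreeRates.toRateCertificate : RateCertificate ξ`** (`growthRate = log λ`, `decayRate = log λ − log ν`);
add proven denominators to get a `RowCertificate` (§10.2). Tools: `PoincareRecurrence.tendsto_ratio_of_recurrence₃`,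
`tendsto_log_abs_div_of_tendsto_ratio` (Literature), `TailSqueeze.tendsto_log_abs_lim_sub_div` (typer). No named facts.
-/

noncomputable section

open Filter Topology
open Literature.Analysis.Asymptotics.PoincareRecurrence

namespace Summit.KontsevichZagierPeriods.Zeta5Search.Certificates

/-- **Order-3 rate data** for rational forms `uₙξ − vₙ`: positive gauges `U` of `|uₙ|` and `W` of the
Casoratian `|uₙvₙ₊₁ − uₙ₊₁vₙ|`, each solving a Poincaré-type order-3 recurrence with a certified ratio box,
the dominant roots `λ` (of `U`) and `ν` (of `W`), contraction conditions, and `vₙ/uₙ → ξ`. -/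
structure OrderThreeRates (ξ : ℝ) where
  /-- the coefficients `uₙ` of `ξ` -/
  u : ℕ → ℚ
  /-- the companions `vₙ` -/
  v : ℕ → ℚ
  /-- threshold index -/
  N : ℕ
  /-- positive gauge of `|uₙ|` -/
  U : ℕ → ℝ
  /-- `|uₙ| = Uₙ` for `n ≥ N` -/
  absU : ∀ n, N ≤ n → |(u n : ℝ)| = U n
  /-- recurrence coefficient of `U(n+2)` -/
  a : ℕ → ℝ
  /-- recurrence coefficient of `U(n+1)` -/
  b : ℕ → ℝ
  /-- recurrence coefficient of `U n` -/
  c : ℕ → ℝ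
  /-- `U(n+3) = aₙU(n+2) + bₙU(n+1) + cₙUₙ` for `n ≥ N` -/
  recU : ∀ n, N ≤ n → U (n + 3) = a n * U (n + 2) + b n * U (n + 1) + c n * U n
  /-- limit of `aₙ` -/
  A : ℝ
  /-- limit of `bₙ` -/
  B : ℝ
  /-- limit of `cₙ` -/
  C : ℝ
  /-- `aₙ → A` -/
  tendsto_a : Tendsto a atTop (𝓝 A)
  /-- `bₙ → B` -/
  tendsto_b : Tendsto b atTop (𝓝 B)
  /-- `cₙ → C` -/
  tendsto_c : Tendsto c atTop (𝓝 C)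
  /-- lower ratio bound for `U` -/
  L : ℝ
  /-- `0 < L` -/
  L_pos : 0 < L
  /-- the box: `Uₙ > 0` and `L·Uₙ ≤ Uₙ₊₁` for `n ≥ N` -/
  boxU : ∀ n, N ≤ n → 0 < U n ∧ L * U n ≤ U (n + 1)
  /-- the dominant root `λ` -/
  lam : ℝ
  /-- `λ³ = Aλ² + Bλ + C` -/
  charU : lam ^ 3 = A * lam ^ 2 + B * lam + C
  /-- `L ≤ λ` -/
  L_le : L ≤ lam
  /-- Poincaré contraction for `U`: `|B|/L² + 2|C|/L³ < 1` -/
  contrU : |B| / L ^ 2 + 2 * |C| / L ^ 3 < 1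
  /-- positive gauge of the Casoratian -/
  W : ℕ → ℝ
  /-- `|uₙvₙ₊₁ − uₙ₊₁vₙ| = Wₙ` for `n ≥ N` -/
  absW : ∀ n, N ≤ n → |(u n : ℝ) * v (n + 1) - u (n + 1) * v n| = W n
  /-- recurrence coefficient of `W(n+2)` -/
  aW : ℕ → ℝ
  /-- recurrence coefficient of `W(n+1)` -/
  bW : ℕ → ℝ
  /-- recurrence coefficient of `W n` -/
  cW : ℕ → ℝ
  /-- `W(n+3) = aWₙW(n+2) + bWₙW(n+1) + cWₙWₙ` for `n ≥ N` -/
  recW : ∀ n, N ≤ n → W (n + 3) = aW n * W (n + 2) + bW n * W (n + 1) + cW n * W n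
  /-- limit of `aWₙ` -/
  AW : ℝ
  /-- limit of `bWₙ` -/
  BW : ℝ
  /-- limit of `cWₙ` -/
  CW : ℝ
  /-- `aWₙ → AW` -/
  tendsto_aW : Tendsto aW atTop (𝓝 AW)
  /-- `bWₙ → BW` -/
  tendsto_bW : Tendsto bW atTop (𝓝 BW)
  /-- `cWₙ → CW` -/
  tendsto_cW : Tendsto cW atTop (𝓝 CW)
  /-- lower ratio bound for `W` -/
  LW : ℝ
  /-- upper ratio bound for `W` -/
  LamW : ℝ
  /-- `0 < LW` -/
  LW_pos : 0 < LW
  /-- the box: `Wₙ > 0`, `LW·Wₙ ≤ Wₙ₊₁ ≤ LamW·Wₙ` for `n ≥ N` -/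
  boxW : ∀ n, N ≤ n → 0 < W n ∧ LW * W n ≤ W (n + 1) ∧ W (n + 1) ≤ LamW * W n
  /-- the dominant root `ν` of the Casoratian recurrence -/
  nu : ℝ
  /-- `ν³ = AW ν² + BW ν + CW` -/
  charW : nu ^ 3 = AW * nu ^ 2 + BW * nu + CW
  /-- `LW ≤ ν` -/
  LW_le : LW ≤ nu
  /-- Poincaré contraction for `W`: `|BW|/LW² + 2|CW|/LW³ < 1` -/
  contrW : |BW| / LW ^ 2 + 2 * |CW| / LW ^ 3 < 1
  /-- tail-squeeze contraction `Λ_W/L² < 1/2` -/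
  theta_lt : LamW / L ^ 2 < 1 / 2
  /-- the forms decay: `ν < λ` -/
  nu_lt : nu < lam
  /-- the identification of the limit: `vₙ/uₙ → ξ` -/
  tendsto_div : Tendsto (fun n : ℕ => (v n : ℝ) / u n) atTop (𝓝 ξ)

namespace OrderThreeRates

variable {ξ : ℝ} (D : OrderThreeRates ξ)

/-- `λ > 0`. -/
theorem lam_pos : 0 < D.lam := D.L_pos.trans_le D.L_le

/-- `ν > 0`. -/
theorem nu_pos : 0 < D.nu := D.LW_pos.trans_le D.LW_le

/-- `Uₙ > 0` for `n ≥ N`. -/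
theorem U_pos (n : ℕ) (hn : D.N ≤ n) : 0 < D.U n := (D.boxU n hn).1

/-- `Wₙ > 0` for `n ≥ N`. -/
theorem W_pos (n : ℕ) (hn : D.N ≤ n) : 0 < D.W n := (D.boxW n hn).1

/-- `uₙ ≠ 0` for `n ≥ N`. -/
theorem u_ne_zero (n : ℕ) (hn : D.N ≤ n) : (D.u n : ℝ) ≠ 0 := by
  have h := D.absU n hn
  intro h0
  rw [h0, abs_zero] at h
  linarith [D.U_pos n hn]

/-- **The Casoratian does not vanish** for `n ≥ N`. -/
theorem casoratian_ne_zero (n : ℕ) (hn : D.N ≤ n) : D.u n * D.v (n + 1) ≠ D.u (n + 1) * D.v n := by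
  intro h
  have hw := D.absW n hn
  have h' : (D.u n : ℝ) * D.v (n + 1) - D.u (n + 1) * D.v n = 0 := by
    have := congrArg (fun x : ℚ => (x : ℝ)) h
    push_cast at this
    linarith
  rw [h', abs_zero] at hw
  linarith [D.W_pos n hn]

/-! ### Growth: Poincaré on `U` -/

/-- `Uₙ₊₁/Uₙ → λ`. -/
theorem tendsto_ratio_U : Tendsto (fun n : ℕ => D.U (n + 1) / D.U n) atTop (𝓝 D.lam) :=
  tendsto_ratio_of_recurrence₃ D.U D.a D.b D.c D.N D.recU D.tendsto_a D.tendsto_b D.tendsto_c D.L_pos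
    (fun n hn => (D.U_pos n hn).ne') (fun n hn => by
      rw [le_div_iff₀ (D.U_pos n hn)]; exact (D.boxU n hn).2) D.charU D.L_le D.contrU

/-- **Exact growth**: `log|uₙ|/n → log λ`. -/
theorem tendsto_log_abs_u_div :
    Tendsto (fun n : ℕ => Real.log |(D.u n : ℝ)| / n) atTop (𝓝 (Real.log D.lam)) := by
  have h := tendsto_log_abs_div_of_tendsto_ratio D.U D.N (fun n hn => (D.U_pos n hn).ne')
    D.lam_pos.ne' D.tendsto_ratio_U
  rw [abs_of_pos D.lam_pos] at h
  refine h.congr' ?_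
  filter_upwards [eventually_ge_atTop D.N] with n hn
  rw [D.absU n hn, abs_of_pos (D.U_pos n hn)]

/-! ### The Casoratian: Poincaré on `W` -/

/-- `Wₙ₊₁/Wₙ → ν`. -/
theorem tendsto_ratio_W : Tendsto (fun n : ℕ => D.W (n + 1) / D.W n) atTop (𝓝 D.nu) :=
  tendsto_ratio_of_recurrence₃ D.W D.aW D.bW D.cW D.N D.recW D.tendsto_aW D.tendsto_bW D.tendsto_cW
    D.LW_pos (fun n hn => (D.W_pos n hn).ne') (fun n hn => by
      rw [le_div_iff₀ (D.W_pos n hn)]; exact (D.boxW n hn).2.1) D.charW D.LW_le D.contrW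

/-- **Exact Casoratian rate**: `log Wₙ/n → log ν`. -/
theorem tendsto_log_W_div :
    Tendsto (fun n : ℕ => Real.log (D.W n) / n) atTop (𝓝 (Real.log D.nu)) := by
  have h := tendsto_log_abs_div_of_tendsto_ratio D.W D.N (fun n hn => (D.W_pos n hn).ne')
    D.nu_pos.ne' D.tendsto_ratio_W
  rw [abs_of_pos D.nu_pos] at h
  refine h.congr' ?_
  filter_upwards [eventually_ge_atTop D.N] with n hn
  rw [abs_of_pos (D.W_pos n hn)]

/-! ### The steps `vₙ₊₁/uₙ₊₁ − vₙ/uₙ` and the tail squeeze -/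

/-- The approximants `rₙ = vₙ/uₙ`. -/
def r (n : ℕ) : ℝ := (D.v n : ℝ) / D.u n

/-- `|rₙ₊₁ − rₙ| = Wₙ/(UₙUₙ₊₁)` for `n ≥ N`. -/
theorem abs_step_eq (n : ℕ) (hn : D.N ≤ n) :
    |D.r (n + 1) - D.r n| = D.W n / (D.U n * D.U (n + 1)) := by
  have hu0 := D.u_ne_zero n hn
  have hu1 := D.u_ne_zero (n + 1) (by omega)
  have e : D.r (n + 1) - D.r n =
      ((D.u n : ℝ) * D.v (n + 1) - D.u (n + 1) * D.v n) / ((D.u n : ℝ) * D.u (n + 1)) := by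
    unfold r; field_simp
  rw [e, abs_div, abs_mul, D.absW n hn, D.absU n hn, D.absU (n + 1) (by omega)]

/-- The steps do not vanish (`n ≥ N`). -/
theorem step_ne_zero (n : ℕ) (hn : D.N ≤ n) : D.r (n + 1) ≠ D.r n := by
  intro h
  have h0 := D.abs_step_eq n hn
  rw [h, sub_self, abs_zero] at h0
  have : 0 < D.W n / (D.U n * D.U (n + 1)) :=
    div_pos (D.W_pos n hn) (mul_pos (D.U_pos n hn) (D.U_pos (n + 1) (by omega)))
  linarith

/-- **Step contraction**: `|rₙ₊₂ − rₙ₊₁| ≤ (Λ_W/L²)·|rₙ₊₁ − rₙ|` for `n ≥ N`. -/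
theorem step_contraction (n : ℕ) (hn : D.N ≤ n) :
    |D.r (n + 2) - D.r (n + 1)| ≤ D.LamW / D.L ^ 2 * |D.r (n + 1) - D.r n| := by
  rw [show n + 2 = n + 1 + 1 by rfl, D.abs_step_eq (n + 1) (by omega), D.abs_step_eq n hn]
  have hU0 := D.U_pos n hn
  have hU1 := D.U_pos (n + 1) (by omega)
  have hU2 := D.U_pos (n + 2) (by omega)
  have hW0 := D.W_pos n hn
  have hL := D.L_pos
  obtain ⟨-, -, hWup⟩ := D.boxW n hn
  have hL1 : D.L * D.U (n + 1) ≤ D.U (n + 2) := (D.boxU (n + 1) (by omega)).2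
  have hL0 : D.L * D.U n ≤ D.U (n + 1) := (D.boxU n hn).2
  -- `U(n+2) ≥ L² Uₙ`
  have hL2 : D.L ^ 2 * D.U n ≤ D.U (n + 2) := by nlinarith
  have hLamW : 0 ≤ D.LamW := by
    obtain ⟨h1, h2, h3⟩ := D.boxW n hn
    nlinarith [mul_pos D.LW_pos h1]
  rw [show n + 1 + 1 = n + 2 by rfl, div_le_iff₀ (mul_pos hU1 hU2)]
  calc D.W (n + 1) ≤ D.LamW * D.W n := hWup
    _ = D.LamW / D.L ^ 2 * (D.W n / (D.U n * D.U (n + 1))) * (D.U (n + 1) * (D.L ^ 2 * D.U n)) := by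
        field_simp
    _ ≤ D.LamW / D.L ^ 2 * (D.W n / (D.U n * D.U (n + 1))) * (D.U (n + 1) * D.U (n + 2)) := by
        have h0 : 0 ≤ D.LamW / D.L ^ 2 * (D.W n / (D.U n * D.U (n + 1))) := by positivity
        have h1 : D.U (n + 1) * (D.L ^ 2 * D.U n) ≤ D.U (n + 1) * D.U (n + 2) :=
          mul_le_mul_of_nonneg_left hL2 hU1.le
        exact mul_le_mul_of_nonneg_left h1 h0

/-- **Exact step rate**: `log|rₙ₊₁ − rₙ|/n → log ν − 2 log λ`. -/
theorem tendsto_log_abs_step_div :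
    Tendsto (fun n : ℕ => Real.log |D.r (n + 1) - D.r n| / n) atTop (𝓝 (Real.log D.nu - 2 * Real.log D.lam)) := by
  -- `log Wₙ/n − log Uₙ/n − log Uₙ₊₁/n`
  have hU := D.tendsto_log_abs_u_div
  have hU1 : Tendsto (fun n : ℕ => Real.log |(D.u (n + 1) : ℝ)| / n) atTop (𝓝 (Real.log D.lam)) := by
    have h1 : Tendsto (fun n : ℕ => Real.log |(D.u (n + 1) : ℝ)| / ((n : ℝ) + 1)) atTop (𝓝 (Real.log D.lam)) := by
      have := (tendsto_add_atTop_iff_nat 1).2 hU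
      refine this.congr fun n => ?_
      push_cast; ring_nf
    have h2 : Tendsto (fun n : ℕ => ((n : ℝ) + 1) / n) atTop (𝓝 1) := by
      have : Tendsto (fun n : ℕ => (1 : ℝ) + 1 / ((n : ℝ))) atTop (𝓝 (1 + 0)) :=
        (tendsto_const_nhds (x := (1 : ℝ))).add tendsto_one_div_atTop_nhds_zero_nat
      rw [add_zero] at this
      refine this.congr' ?_
      filter_upwards [eventually_gt_atTop 0] with n hn
      have hn0 : (n : ℝ) ≠ 0 := by exact_mod_cast hn.ne'
      field_simp
    have h3 := h1.mul h2
    rw [mul_one] at h3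
    refine h3.congr' ?_
    filter_upwards [eventually_gt_atTop 0] with n hn
    have hn0 : (n : ℝ) ≠ 0 := by exact_mod_cast hn.ne'
    have hn1 : (n : ℝ) + 1 ≠ 0 := by positivity
    field_simp
  have h := (D.tendsto_log_W_div.sub hU).sub hU1
  have e : Real.log D.nu - Real.log D.lam - Real.log D.lam = Real.log D.nu - 2 * Real.log D.lam := by ring
  rw [e] at h
  refine h.congr' ?_
  filter_upwards [eventually_ge_atTop D.N] with n hn
  have hU0 := D.U_pos n hn
  have hUn1 := D.U_pos (n + 1) (by omega)
  rw [D.abs_step_eq n hn, D.absU n hn, D.absU (n + 1) (by omega),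
    Real.log_div (D.W_pos n hn).ne' (mul_pos hU0 hUn1).ne', Real.log_mul hU0.ne' hUn1.ne']
  ring

/-- **Exact approximation rate**: `log|ξ − vₙ/uₙ|/n → log ν − 2 log λ` (tail squeeze). -/
theorem tendsto_log_abs_sub_div :
    Tendsto (fun n : ℕ => Real.log |ξ - (D.v n : ℝ) / D.u n| / n) atTop
      (𝓝 (Real.log D.nu - 2 * Real.log D.lam)) := by
  have hθ0 : 0 ≤ D.LamW / D.L ^ 2 := by
    obtain ⟨h1, h2, h3⟩ := D.boxW D.N le_rfl
    have : 0 ≤ D.LamW := by nlinarith [mul_pos D.LW_pos h1]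
    exact div_nonneg this (sq_nonneg _)
  exact TailSqueeze.tendsto_log_abs_lim_sub_div D.r D.N hθ0 D.theta_lt D.tendsto_div
    (fun k hk => D.step_contraction k hk) (fun k hk => D.step_ne_zero k hk) D.tendsto_log_abs_step_div

/-- The error `ξ − vₙ/uₙ` does not vanish for `n ≥ N`. -/
theorem sub_ne_zero (n : ℕ) (hn : D.N ≤ n) : ξ - (D.v n : ℝ) / D.u n ≠ 0 := by
  have hθ0 : 0 ≤ D.LamW / D.L ^ 2 := by
    obtain ⟨h1, h2, h3⟩ := D.boxW D.N le_rfl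
    have : 0 ≤ D.LamW := by nlinarith [mul_pos D.LW_pos h1]
    exact div_nonneg this (sq_nonneg _)
  exact TailSqueeze.lim_sub_ne_zero D.r D.N hθ0 D.theta_lt D.tendsto_div
    (fun k hk => D.step_contraction k hk) n hn (D.step_ne_zero n hn)

/-- **The forms do not vanish** for `n ≥ N`. -/
theorem form_ne_zero (n : ℕ) (hn : D.N ≤ n) : (D.u n : ℝ) * ξ - D.v n ≠ 0 := by
  have h := D.sub_ne_zero n hn
  have hu := D.u_ne_zero n hn
  have hfe : (D.u n : ℝ) * ξ - D.v n = D.u n * (ξ - (D.v n : ℝ) / D.u n) := by field_simp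
  rw [hfe]
  exact mul_ne_zero hu h

/-- **Exact decay of the forms**: `log|uₙξ − vₙ|/n → log ν − log λ`. -/
theorem tendsto_log_abs_form_div :
    Tendsto (fun n : ℕ => Real.log |(D.u n : ℝ) * ξ - D.v n| / n) atTop
      (𝓝 (Real.log D.nu - Real.log D.lam)) := by
  have h := D.tendsto_log_abs_u_div.add D.tendsto_log_abs_sub_div
  have e : Real.log D.lam + (Real.log D.nu - 2 * Real.log D.lam) = Real.log D.nu - Real.log D.lam := by ring
  rw [e] at h
  refine h.congr' ?_
  filter_upwards [eventually_ge_atTop D.N] with n hn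
  have hu := D.u_ne_zero n hn
  have he := abs_pos.2 (D.sub_ne_zero n hn)
  have hfe : (D.u n : ℝ) * ξ - D.v n = D.u n * (ξ - (D.v n : ℝ) / D.u n) := by field_simp
  rw [hfe, abs_mul, Real.log_mul (abs_pos.2 hu).ne' he.ne', add_div]

/-- **Order-3 data ⇒ rate certificate**: `growthRate = log λ`, `decayRate = log λ − log ν`. -/
def toRateCertificate : RateCertificate ξ where
  u := D.u
  v := D.v
  growthRate := Real.log D.lam
  decayRate := Real.log D.lam - Real.log D.nu
  tendsto_growth := D.tendsto_log_abs_u_div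
  tendsto_decay := by
    have h := D.tendsto_log_abs_form_div
    rw [show Real.log D.nu - Real.log D.lam = -(Real.log D.lam - Real.log D.nu) by ring] at h
    exact h
  decayRate_pos := by
    have := Real.log_lt_log D.nu_pos D.nu_lt
    linarith

/-- The growth rate of the produced certificate is `log λ`. -/
theorem toRateCertificate_growthRate : D.toRateCertificate.growthRate = Real.log D.lam := rfl

/-- The decay rate of the produced certificate is `log λ − log ν`. -/
theorem toRateCertificate_decayRate :
    D.toRateCertificate.decayRate = Real.log D.lam - Real.log D.nu := rfl

/-- The Casoratian of the produced certificate is eventually non-zero (input of `RowCertificate.not_liouvilleWith`). -/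
theorem eventually_casoratian_ne_zero :
    ∀ᶠ n : ℕ in atTop, D.u n * D.v (n + 1) ≠ D.u (n + 1) * D.v n := by
  filter_upwards [eventually_ge_atTop D.N] with n hn
  exact D.casoratian_ne_zero n hn

end OrderThreeRates

end Summit.KontsevichZagierPeriods.Zeta5Search.Certificates
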